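import Summits.BirchSwinnertonDyer.BirchSwinnertonDyer.Theorems.ResidualThetaTransportAtTwoSignedMuSeedAtTwoPlusTiltCurve
import HarnessLib

/-!
# Rotations are DIAGONAL on the tilt curve: `[ζ]_f(t) = ζ·t` for `ζ³ = 1` on the Lubin–Tate module of `y² + y = x³` over `ℤ₄`,
# and the `ℤ/3`-grading of `w`, `i`, `[n]`, `F` for every `j = 0` model `y² + a₃y = x³ + a₆`
# (seed crux `SignedMuSeedAtTwoPlus` stmt-BirchSwinnertonDyer-21438, lines `norm-field-tilt` / `jet-character-sums`; Kμ⁺ stmt-BirchSwinnertonDyer-20689)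

Cell `bsd-wall`, width seat `bsd-wall-rtt-p4-w2` g13 (`--supports`, closes nothing).  THEOREMS ONLY (no `def`, no named fact, no instance,
no `sorry`); the lines are NOT registered (W-79); BSD is not proved by this.

WHY.  The jet card (`Cruxes/SignedMuSeedAtTwoPlus/Lines/jet-character-sums.md`, J3 and the «Convention caveat») and `JetKernel.md` §1b need
«rotations are diagonal: `[ζ₃]t = ζ₃·t`, so `μ_c = [t⁴][z_c] = 0` for `c ∈ μ₃`», and `…JetRhoSymmetrisation` (p673611) is stated under exactly
this convention.  Here it is a THEOREM for the tree's objects: the automorphism `(x, y) ↦ (ζx, y)` of a `j = 0` model acts on `z = −x/y` by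
`z ↦ ζz` and fixes `w = −1/y`, so every series of the chord–tangent construction is `ℤ/3`-homogeneous.

WHAT (`W` a Weierstrass equation over a commutative ring `R` with `a₁ = a₂ = a₄ = 0`; `ζ ∈ R`, `ζ³ = 1`; `rescale` = Mathlib's `z ↦ ζz`):
* §0 substitution bookkeeping (any ring): `mvRescale_powerSeries_subst`, `subst_smul_eq_rescale_subst`, `rescale_mvSubst_pair`.
* §1 `rescale_formalW` (`w(ζz) = w(z)`, fixed-point uniqueness), `rescale_formalNeg` (`i(ζz) = ζ·i(z)`), `rescale_formalSlope` (`λ ↦ ζ²λ`),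
  `rescale_formalIntercept` (`ν ↦ ν`), `rescale_formalChordZ` (`z₃ ↦ ζz₃`), **`rescale_formalGroupLaw`** (`F(ζz₀, ζz₁) = ζ·F(z₀, z₁)`),
  **`rescale_formalMul`** (`[n](ζt) = ζ·[n](t)`), `rescale_formalNeg_subst_formalMul` (`f_W(ζt) = ζ f_W(t)` for `f_W = i([p]t)`).
* §2 **`hom_eq_C_mul_X_of_pow_three`**: over any Lubin–Tate base `A` for `(−2, 4)` and the tilt curve `U = (y² + y = x³)`:
  `LubinTate.hom hA hf_U hf_U ζ = C ζ · X` for every `ζ ∈ A` with `ζ³ = 1` (Lubin–Tate uniqueness `eq_hom`); over `ℤ₄ = 𝒪_{ℚ₂(ζ₃)}`: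
  `hom_zeta_tiltCurve_zFour`.

References: [SilvermanAEC2009] III.10 (automorphisms of `j = 0` curves), IV.1–IV.2; [LubinTate1965] §1 Thm. 1 (uniqueness of `[a]_f`).
-/

noncomputable section

set_option autoImplicit false
-- the Theorems namespace of this sub repeats the summit name by design (D-0017 nested layout)
set_option linter.dupNamespace false

open scoped Classical IntermediateField
open PowerSeries WeierstrassCurve
open Literature.NumberTheory.EllipticCurves
open Literature.NumberTheory.GaloisRepresentations
open Summit.BirchSwinnertonDyer.BirchSwinnertonDyer.Theorems.RelativeLubinTate
open Summit.BirchSwinnertonDyer.BirchSwinnertonDyer.Theorems.RelativeLubinTate.ZFour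

namespace Summit.BirchSwinnertonDyer.BirchSwinnertonDyer.Theorems.SignedMuAtTwo.Tilt

/-! ## §0 Substitution bookkeeping -/

section Subst

variable {R : Type*} [CommRing R]

/-- `(g ∘ z)(a·X) = g(z(a·X))`: rescaling the variables commutes with an outer one-variable substitution. [folklore] -/
theorem mvRescale_powerSeries_subst {σ : Type*} (a : σ → R) (g : R⟦X⟧) {z : MvPowerSeries σ R}
    (hz : MvPowerSeries.constantCoeff z = 0) :
    MvPowerSeries.rescale a (g.subst z) = g.subst (MvPowerSeries.rescale a z) := by
  rw [MvPowerSeries.rescale_eq_subst, MvPowerSeries.rescale_eq_subst,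
    mvSubst_powerSeries_subst (PowerSeries.HasSubst.of_constantCoeff_zero hz) (MvPowerSeries.HasSubst.smul_X a)]

/-- `g(c·z) = (g(c·X))(z)`: a scalar inside a substitution is a rescaling of the outer series. [folklore] -/
theorem subst_smul_eq_rescale_subst {σ : Type*} (c : R) (g : R⟦X⟧) {z : MvPowerSeries σ R}
    (hz : MvPowerSeries.constantCoeff z = 0) :
    g.subst (c • z) = (PowerSeries.rescale c g).subst z := by
  have hzs : PowerSeries.HasSubst z := PowerSeries.HasSubst.of_constantCoeff_zero hz
  rw [PowerSeries.rescale_eq_subst, PowerSeries.subst_comp_subst_apply (HasSubst.smul_X' c) hzs,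
    PowerSeries.subst_smul hzs, PowerSeries.subst_X hzs]

/-- `(F(p, q))(c·t) = F(p(c·t), q(c·t))`: rescaling commutes with a two-variable substitution into one variable. [folklore] -/
theorem rescale_mvSubst_pair (c : R) (F : MvPowerSeries (Fin 2) R) {p q : R⟦X⟧}
    (hp : constantCoeff p = 0) (hq : constantCoeff q = 0) :
    PowerSeries.rescale c (MvPowerSeries.subst ![p, q] F) =
      MvPowerSeries.subst ![PowerSeries.rescale c p, PowerSeries.rescale c q] F := by
  have hpq : MvPowerSeries.HasSubst ![p, q] :=
    MvPowerSeries.hasSubst_of_constantCoeff_zero fun i => by fin_cases i <;> assumption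
  rw [PowerSeries.rescale_eq, MvPowerSeries.rescale_eq_subst,
    MvPowerSeries.subst_comp_subst_apply hpq (MvPowerSeries.HasSubst.smul_X _)]
  congr 1
  funext i
  fin_cases i
  · simp only [Fin.zero_eta, Matrix.cons_val_zero]
    rw [PowerSeries.rescale_eq, MvPowerSeries.rescale_eq_subst]
  · simp only [Fin.mk_one, Matrix.cons_val_one, Matrix.cons_val_zero]
    rw [PowerSeries.rescale_eq, MvPowerSeries.rescale_eq_subst]

/-- `F(c·p, c·q) = (F(c z₀, c z₁))(p, q)`. [folklore] -/
theorem mvSubst_pair_smul (c : R) (F : MvPowerSeries (Fin 2) R) {p q : R⟦X⟧}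
    (hp : constantCoeff p = 0) (hq : constantCoeff q = 0) :
    MvPowerSeries.subst ![c • p, c • q] F = MvPowerSeries.subst ![p, q] (MvPowerSeries.rescale (fun _ => c) F) := by
  have hpq : MvPowerSeries.HasSubst ![p, q] :=
    MvPowerSeries.hasSubst_of_constantCoeff_zero fun i => by fin_cases i <;> assumption
  rw [MvPowerSeries.rescale_eq_subst, MvPowerSeries.subst_comp_subst_apply (MvPowerSeries.HasSubst.smul_X _) hpq]
  congr 1
  funext i
  rw [Pi.smul_apply', ← MvPowerSeries.coe_substAlgHom hpq, map_smul, MvPowerSeries.coe_substAlgHom, MvPowerSeries.subst_X hpq]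
  fin_cases i <;> rfl

end Subst

/-! ## §1 `j = 0` models `y² + a₃y = x³ + a₆`: every series of the chord–tangent construction is `ℤ/3`-homogeneous -/

section JZero

variable {R : Type*} [CommRing R] (W : WeierstrassCurve R) (h₁ : W.a₁ = 0) (h₂ : W.a₂ = 0) (h₄ : W.a₄ = 0)
  {ζ : R} (hζ : ζ ^ 3 = 1)

include h₁ h₂ h₄ hζ in
/-- **`w(ζz) = w(z)`** for `y² + a₃y = x³ + a₆` and `ζ³ = 1`: both sides solve `w = z³ + a₃w² + a₆w³` (AEC IV.1.1 uniqueness).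
[cite: SilvermanAEC2009, IV.1.1] -/
theorem rescale_formalW : PowerSeries.rescale ζ W.formalW = W.formalW := by
  have hw : W.formalW = W.formalWStep W.formalW := W.formalWStep_formalW.symm
  rw [formalWStep, h₁, h₂, h₄] at hw
  simp only [map_zero, zero_mul, add_zero] at hw
  -- `hw : w = X³ + C a₃ w² + C a₆ w³`
  have hζC : (PowerSeries.C ζ : R⟦X⟧) ^ 3 = 1 := by rw [← map_pow, hζ, map_one]
  have hw' : PowerSeries.rescale ζ W.formalW =
      X ^ 3 + C W.a₃ * (PowerSeries.rescale ζ W.formalW) ^ 2 + C W.a₆ * (PowerSeries.rescale ζ W.formalW) ^ 3 := by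
    conv_lhs => rw [hw]
    simp only [map_add, map_mul, map_pow, PowerSeries.rescale_X]
    have hC : ∀ a : R, PowerSeries.rescale ζ (C a) = C a := fun a => by
      ext n; rw [PowerSeries.coeff_rescale, coeff_C]; split_ifs with h <;> simp [h]
    rw [hC, hC, mul_pow, hζC, one_mul]
  refine W.fixedPoint_unique (σ := Unit) (g := (X : R⟦X⟧)) PowerSeries.constantCoeff_X ?_ W.constantCoeff_formalW ?_ ?_
  · show PowerSeries.constantCoeff (PowerSeries.rescale ζ W.formalW) = 0
    rw [← PowerSeries.coeff_zero_eq_constantCoeff_apply, PowerSeries.coeff_rescale, PowerSeries.coeff_zero_eq_constantCoeff_apply,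
      W.constantCoeff_formalW, mul_zero]
  · show PowerSeries.rescale ζ W.formalW = _
    rw [h₁, h₂, h₄]
    simp only [map_zero, zero_mul, add_zero]
    exact hw'
  · show W.formalW = _
    rw [h₁, h₂, h₄]
    simp only [map_zero, zero_mul, add_zero]
    exact hw

include h₁ h₂ h₄ hζ in
/-- The coefficients of `w` vanish off degrees `≡ 0 (mod 3)`, in the form `ζⁿ·[zⁿ]w = [zⁿ]w`. [cite: SilvermanAEC2009, IV.1.1] -/
theorem pow_mul_coeff_formalW (n : ℕ) : ζ ^ n * coeff n W.formalW = coeff n W.formalW := by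
  have h := congrArg (coeff n) (rescale_formalW W h₁ h₂ h₄ hζ)
  rwa [PowerSeries.coeff_rescale] at h

include h₁ h₂ h₄ hζ in
/-- **`λ(ζz₀, ζz₁) = ζ²·λ(z₀, z₁)`** for the chord slope of `y² + a₃y = x³ + a₆`, `ζ³ = 1`. [cite: SilvermanAEC2009, IV.1.1] -/
theorem rescale_formalSlope :
    MvPowerSeries.rescale (fun _ => ζ) W.formalSlope = MvPowerSeries.C ζ ^ 2 * W.formalSlope := by
  ext d
  rw [MvPowerSeries.coeff_rescale, ← map_pow, MvPowerSeries.coeff_C_mul, Finsupp.prod_pow, Fin.prod_univ_two, ← pow_add]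
  have hc : MvPowerSeries.coeff d W.formalSlope = coeff (d 0 + d 1 + 1) W.formalW := rfl
  rw [hc]
  have key := pow_mul_coeff_formalW W h₁ h₂ h₄ hζ (d 0 + d 1 + 1)
  linear_combination ζ ^ 2 * key + (-(ζ ^ (d 0 + d 1) * coeff (d 0 + d 1 + 1) W.formalW)) * hζ

/-- `(z₀, z₁) ↦ (ζz₀, ζz₁)` on a variable. [folklore] -/
theorem mvRescale_X (c : R) (i : Fin 2) :
    MvPowerSeries.rescale (fun _ => c) (MvPowerSeries.X i : MvPowerSeries (Fin 2) R) = MvPowerSeries.C c * MvPowerSeries.X i := by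
  rw [MvPowerSeries.rescale_eq_subst, MvPowerSeries.subst_X (MvPowerSeries.HasSubst.smul_X _), Pi.smul_apply',
    MvPowerSeries.smul_eq_C_mul]

include h₁ h₂ h₄ hζ in
/-- **`ν(ζz₀, ζz₁) = ν(z₀, z₁)`** for the chord intercept of `y² + a₃y = x³ + a₆`, `ζ³ = 1`. [cite: SilvermanAEC2009, IV.1.1] -/
theorem rescale_formalIntercept :
    MvPowerSeries.rescale (fun _ => ζ) W.formalIntercept = W.formalIntercept := by
  have hX0 : MvPowerSeries.constantCoeff (MvPowerSeries.X 0 : MvPowerSeries (Fin 2) R) = 0 := MvPowerSeries.constantCoeff_X 0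
  have hw : MvPowerSeries.rescale (fun _ => ζ) (W.formalW.subst (MvPowerSeries.X 0 : MvPowerSeries (Fin 2) R)) =
      W.formalW.subst (MvPowerSeries.X 0 : MvPowerSeries (Fin 2) R) := by
    rw [mvRescale_powerSeries_subst _ _ hX0, mvRescale_X, ← MvPowerSeries.smul_eq_C_mul, subst_smul_eq_rescale_subst _ _ hX0,
      rescale_formalW W h₁ h₂ h₄ hζ]
  have hC3 : MvPowerSeries.C ζ ^ 3 = (1 : MvPowerSeries (Fin 2) R) := by rw [← map_pow, hζ, map_one]
  rw [formalIntercept, map_sub, map_mul, hw, rescale_formalSlope W h₁ h₂ h₄ hζ, mvRescale_X]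
  linear_combination (-(W.formalSlope * MvPowerSeries.X 0)) * hC3

include h₁ in
/-- **`i(ζz) = ζ·i(z)`** for the formal inverse of `y² + a₃y = x³ + a₆` (indeed of any model with `a₁ = 0` once `w(ζz) = w(z)`):
from `i·(1 − a₃w) = −z`. [cite: SilvermanAEC2009, IV.1.1] -/
theorem rescale_formalNeg_of_rescale_formalW (hw : PowerSeries.rescale ζ W.formalW = W.formalW) :
    PowerSeries.rescale ζ W.formalNeg = C ζ * W.formalNeg := by
  have hE := W.formalNegDenom_mul_invOfUnit
  have hi : W.formalNeg * (1 - C W.a₁ * X - C W.a₃ * W.formalW) = -X := by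
    rw [W.formalNeg_eq]; linear_combination (-X) * hE
  rw [h₁, map_zero, zero_mul, sub_zero] at hi hE
  have hC : ∀ a : R, PowerSeries.rescale ζ (C a) = C a := fun a => by
    ext n; rw [PowerSeries.coeff_rescale, coeff_C]; split_ifs with h <;> simp [h]
  have hi' := congrArg (PowerSeries.rescale ζ) hi
  rw [map_mul, map_sub, map_one, map_mul, hC, hw, map_neg, PowerSeries.rescale_X] at hi'
  -- `(rescale i − C ζ · i) · E = 0` with `E` a unit
  have hzero : (PowerSeries.rescale ζ W.formalNeg - C ζ * W.formalNeg) * (1 - C W.a₃ * W.formalW) = 0 := by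
    linear_combination hi' - C ζ * hi
  have hu : IsUnit (1 - C W.a₃ * W.formalW) := IsUnit.of_mul_eq_one _ hE
  exact sub_eq_zero.mp ((hu.mul_left_eq_zero).mp hzero)

include h₁ h₂ h₄ hζ in
/-- **`i(ζz) = ζ·i(z)`** for `y² + a₃y = x³ + a₆`, `ζ³ = 1`. [cite: SilvermanAEC2009, IV.1.1] -/
theorem rescale_formalNeg : PowerSeries.rescale ζ W.formalNeg = C ζ * W.formalNeg :=
  rescale_formalNeg_of_rescale_formalW W h₁ (rescale_formalW W h₁ h₂ h₄ hζ)

include h₁ h₂ h₄ hζ in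
/-- **`z₃(ζz₀, ζz₁) = ζ·z₃(z₀, z₁)`** for the third intersection of the chord, `y² + a₃y = x³ + a₆`, `ζ³ = 1`.
[cite: SilvermanAEC2009, IV.1.1] -/
theorem rescale_formalChordZ :
    MvPowerSeries.rescale (fun _ => ζ) W.formalChordZ = MvPowerSeries.C ζ * W.formalChordZ := by
  have hlam := rescale_formalSlope W h₁ h₂ h₄ hζ
  have hnu := rescale_formalIntercept W h₁ h₂ h₄ hζ
  have hD : W.formalChordDenom * MvPowerSeries.invOfUnit W.formalChordDenom 1 = 1 :=
    MvPowerSeries.mul_invOfUnit _ 1 (by simp)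
  have hC3 : MvPowerSeries.C ζ ^ 3 = (1 : MvPowerSeries (Fin 2) R) := by rw [← map_pow, hζ, map_one]
  have hCa : ∀ a : R, MvPowerSeries.rescale (fun _ : Fin 2 => ζ) (MvPowerSeries.C a) = MvPowerSeries.C a := fun a => by
    rw [MvPowerSeries.rescale_eq_subst, MvPowerSeries.subst_C]
  -- the denominator is invariant (`ζ⁶ = 1`)
  have hden : MvPowerSeries.rescale (fun _ => ζ) W.formalChordDenom = W.formalChordDenom := by
    rw [formalChordDenom, h₂, h₄]
    simp only [map_zero, zero_mul, add_zero, map_add, map_one, map_mul, map_pow, hlam, hCa]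
    linear_combination (MvPowerSeries.C W.a₆ * W.formalSlope ^ 3 * (MvPowerSeries.C ζ ^ 3 + 1)) * hC3
  have hinv : MvPowerSeries.rescale (fun _ => ζ) (MvPowerSeries.invOfUnit W.formalChordDenom 1) =
      MvPowerSeries.invOfUnit W.formalChordDenom 1 := by
    have h2 := congrArg (MvPowerSeries.rescale (fun _ : Fin 2 => ζ)) hD
    rw [map_mul, map_one, hden] at h2
    linear_combination (-(MvPowerSeries.rescale (fun _ : Fin 2 => ζ) (MvPowerSeries.invOfUnit W.formalChordDenom 1))) * hD +
      (MvPowerSeries.invOfUnit W.formalChordDenom 1) * h2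
  -- the numerator picks up `ζ⁴ = ζ`
  have hnum : MvPowerSeries.rescale (fun _ => ζ) W.formalChordNum = MvPowerSeries.C ζ * W.formalChordNum := by
    rw [formalChordNum, h₁, h₂, h₄]
    simp only [map_zero, zero_mul, add_zero, zero_add, mul_zero, map_add, map_mul, map_pow, hlam, hnu, map_ofNat, hCa]
    linear_combination ((MvPowerSeries.C W.a₃ * W.formalSlope ^ 2 +
      3 * MvPowerSeries.C W.a₆ * W.formalSlope ^ 2 * W.formalIntercept) * MvPowerSeries.C ζ) * hC3
  rw [formalChordZ, map_sub, map_sub, map_neg, map_mul, mvRescale_X, mvRescale_X, hnum, hinv]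
  ring

include h₁ h₂ h₄ hζ in
/-- **`F(ζz₀, ζz₁) = ζ·F(z₀, z₁)`**: the chord–tangent formal group law of `y² + a₃y = x³ + a₆` is `ℤ/3`-homogeneous of weight `1`
(the automorphism `(x, y) ↦ (ζx, y)` acts on `z = −x/y` by `ζ`), `ζ³ = 1`, every commutative ring. [cite: SilvermanAEC2009, IV.1.1] -/
theorem rescale_formalGroupLaw :
    MvPowerSeries.rescale (fun _ => ζ) W.formalGroupLaw = MvPowerSeries.C ζ * W.formalGroupLaw := by
  have hz0 : MvPowerSeries.constantCoeff W.formalChordZ = 0 := W.constantCoeff_formalChordZ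
  have hC : ∀ a : R, (PowerSeries.C a).subst W.formalChordZ = MvPowerSeries.C a := fun a => PowerSeries.subst_C a
  rw [formalGroupLaw, mvRescale_powerSeries_subst _ _ hz0, rescale_formalChordZ W h₁ h₂ h₄ hζ, ← MvPowerSeries.smul_eq_C_mul,
    subst_smul_eq_rescale_subst _ _ hz0, rescale_formalNeg W h₁ h₂ h₄ hζ, PowerSeries.subst_mul W.hasSubst_formalChordZ, hC]

include h₁ h₂ h₄ hζ in
/-- **`[n](ζt) = ζ·[n](t)`** for the formal multiplication of `y² + a₃y = x³ + a₆`, `ζ³ = 1`. [cite: SilvermanAEC2009, IV.2.3] -/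
theorem rescale_formalMul (n : ℕ) : PowerSeries.rescale ζ (W.formalMul n) = C ζ * W.formalMul n := by
  induction n with
  | zero => simp
  | succ n ih =>
    have hn0 : constantCoeff (W.formalMul n) = 0 := W.constantCoeff_formalMul n
    have hs : MvPowerSeries.HasSubst ![W.formalMul n, (X : R⟦X⟧)] := hasSubst_pair_X hn0
    rw [formalMul_succ, rescale_mvSubst_pair _ _ hn0 PowerSeries.constantCoeff_X, ih, PowerSeries.rescale_X,
      ← PowerSeries.smul_eq_C_mul, ← PowerSeries.smul_eq_C_mul, mvSubst_pair_smul _ _ hn0 PowerSeries.constantCoeff_X,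
      rescale_formalGroupLaw W h₁ h₂ h₄ hζ, MvPowerSeries.subst_mul hs, MvPowerSeries.subst_C]
    rfl

/-- `(f ∘ τ)(ζt) = f(τ(ζt))` in one variable. [folklore] -/
theorem rescale_subst' (c : R) (f : R⟦X⟧) {τ : R⟦X⟧} (hτ : constantCoeff τ = 0) :
    PowerSeries.rescale c (f.subst τ) = f.subst (PowerSeries.rescale c τ) := by
  have hτ' : HasSubst τ := HasSubst.of_constantCoeff_zero' hτ
  rw [PowerSeries.rescale_eq_subst, PowerSeries.rescale_eq_subst, PowerSeries.subst_comp_subst_apply hτ' (HasSubst.smul_X' c)]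

include h₁ h₂ h₄ hζ in
/-- **`f_W(ζt) = ζ·f_W(t)`** for `f_W = i([n]t)` (in particular the Lubin–Tate series `i([p]t)`), `y² + a₃y = x³ + a₆`, `ζ³ = 1`.
[cite: SilvermanAEC2009, IV.2.3] -/
theorem rescale_formalNeg_subst_formalMul (n : ℕ) :
    PowerSeries.rescale ζ (W.formalNeg.subst (W.formalMul n)) = C ζ * W.formalNeg.subst (W.formalMul n) := by
  have hn0 : constantCoeff (W.formalMul n) = 0 := W.constantCoeff_formalMul n
  have hC : ∀ a : R, (PowerSeries.C a).subst (W.formalMul n) = C a := fun a => PowerSeries.subst_C a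
  rw [rescale_subst' _ _ hn0, rescale_formalMul W h₁ h₂ h₄ hζ n, ← PowerSeries.smul_eq_C_mul,
    subst_smul_eq_rescale_subst _ _ hn0, rescale_formalNeg W h₁ h₂ h₄ hζ, PowerSeries.subst_mul (W.hasSubst_formalMul n), hC]

end JZero

/-! ## §2 The tilt curve: `[ζ]_{f_U} = ζ·t` on the relative Lubin–Tate module -/

section Hom

variable {A : Type*} [CommRing A] (hA : LubinTate.IsLTRing (-((2 : ℕ) : A)) (2 ^ 2)) {ζ : A} (hζ : ζ ^ 3 = 1)

include hζ in
/-- **Rotations are diagonal: `[ζ]_{f_U}(t) = ζ·t`** for every `ζ` with `ζ³ = 1` in a Lubin–Tate base `A` for `(−2, 4)`, `U = (y² + y = x³)`,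
`f_U = i_U([2]_U t)` (so for the formal `A`-module structure of `…RelativeLubinTateBase`/`…TiltCurve` on `Û`): the endomorphism `ζ·t`
commutes with `f_U` (`rescale_formalNeg_subst_formalMul`) and has linear term `ζ`, so it IS `[ζ]_f` by Lubin–Tate uniqueness.
[cite: LubinTate1965, §1 Thm. 1] [cite: SilvermanAEC2009, III.10] -/
theorem hom_tiltCurve_eq_C_mul_X :
    LubinTate.hom hA (isLTSeries_tiltCurve A) (isLTSeries_tiltCurve A) ζ = C ζ * X := by
  symm
  have hf0 : constantCoeff ((⟨0, 0, 1, 0, 0⟩ : WeierstrassCurve A).formalNeg.subst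
      ((⟨0, 0, 1, 0, 0⟩ : WeierstrassCurve A).formalMul 2)) = 0 :=
    PowerSeries.constantCoeff_subst_eq_zero (constantCoeff_formalMul _ 2) _ (constantCoeff_formalNeg _)
  have hfs : HasSubst ((⟨0, 0, 1, 0, 0⟩ : WeierstrassCurve A).formalNeg.subst ((⟨0, 0, 1, 0, 0⟩ : WeierstrassCurve A).formalMul 2)) :=
    HasSubst.of_constantCoeff_zero' hf0
  refine LubinTate.eq_hom hA _ _ (by simp) (by simp) ?_
  -- `f(ζt) = ζ·f(t)`
  have hC : ∀ a : A, (PowerSeries.C a).subst ((⟨0, 0, 1, 0, 0⟩ : WeierstrassCurve A).formalNeg.subst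
      ((⟨0, 0, 1, 0, 0⟩ : WeierstrassCurve A).formalMul 2)) = C a := fun a => PowerSeries.subst_C a
  have hR : PowerSeries.subst ((⟨0, 0, 1, 0, 0⟩ : WeierstrassCurve A).formalNeg.subst ((⟨0, 0, 1, 0, 0⟩ : WeierstrassCurve A).formalMul 2))
      (C ζ * X) = C ζ * (⟨0, 0, 1, 0, 0⟩ : WeierstrassCurve A).formalNeg.subst ((⟨0, 0, 1, 0, 0⟩ : WeierstrassCurve A).formalMul 2) := by
    rw [PowerSeries.subst_mul hfs, hC, PowerSeries.subst_X hfs]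
  have hL : PowerSeries.subst (C ζ * X : A⟦X⟧)
      ((⟨0, 0, 1, 0, 0⟩ : WeierstrassCurve A).formalNeg.subst ((⟨0, 0, 1, 0, 0⟩ : WeierstrassCurve A).formalMul 2)) =
      C ζ * (⟨0, 0, 1, 0, 0⟩ : WeierstrassCurve A).formalNeg.subst ((⟨0, 0, 1, 0, 0⟩ : WeierstrassCurve A).formalMul 2) := by
    rw [← PowerSeries.smul_eq_C_mul, ← PowerSeries.rescale_eq_subst]
    exact rescale_formalNeg_subst_formalMul _ rfl rfl rfl hζ 2
  exact hL.trans hR.symm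

end Hom

section ZFour

variable {ζ : PadicAlgCl 2} (hζ : ζ ^ 2 + ζ + 1 = 0)

/-- **Over `ℤ₄ = 𝒪_{ℚ₂(ζ₃)}`**: for every `z ∈ 𝒪` with `z³ = 1` (the Teichmüller lifts `1, ζ₃, ζ₃²` of `𝔽₄^×`), `[z]_{f_U}(t) = z·t` on the tilt
curve's Lubin–Tate module (`formalGroupLaw_tiltCurve_zFour_eq_ltF`). [cite: LubinTate1965, §1 Thm. 1] [cite: SilvermanAEC2009, III.10] -/
theorem hom_tiltCurve_zFour_eq_C_mul_X {z : LubinTate.unitBall (↥ℚ_[2]⟮ζ⟯)} (hz : z ^ 3 = 1) :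
    LubinTate.hom (isLTRing_unitBall_adjoin_zeta hζ)
      (isLTSeries_tiltCurve (LubinTate.unitBall (↥ℚ_[2]⟮ζ⟯))) (isLTSeries_tiltCurve (LubinTate.unitBall (↥ℚ_[2]⟮ζ⟯))) z = C z * X :=
  hom_tiltCurve_eq_C_mul_X (isLTRing_unitBall_adjoin_zeta hζ) hz

end ZFour

end Summit.BirchSwinnertonDyer.BirchSwinnertonDyer.Theorems.SignedMuAtTwo.Tilt

end
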